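import Literature.AnabelianGeometry.EtaleTheta.SettingModelTateDeckSignNoGo
import Literature.AnabelianGeometry.EtaleTheta.SettingModelTateDeckDisplayNegOne
import HarnessLib

/-!
# The STAGE-2 («Tate shear») model of [EtTh] §1: the deck-sign clause (P14ii-cl) IS SATISFIED by the
# `log(Ü)`-TWISTED class `η̈♯ · log(Ü)` — «y-sensitivity» is a class choice at the existing group (proof-only; non-vacuity)

S. Mochizuki, *The étale theta function and its Frobenioid-theoretic manifestations*, Publ. RIMS **45** (2009) [EtTh],
Prop. 1.4 (ii), PRIMS PDF p. 22 l. 5–9 («`Θ̈(−Ü) = −Θ̈(Ü)`», the deck transformation `Ü ↦ −Ü` of `Ÿ → Y`); Prop. 1.5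
(ii)/(iii) p. 23 (`log(Ü)`, the theta classes) [cite: MochizukiEtTh2009, Prop 1.4 (ii) p.22].
abc-iut cell, layer L2, seat abc-iut-L2-t12 (gen 10); offer (T) «DECK-TWIST@modelχq» under L2 ROWS #142/#143 (input to
VNEXT add.13 / G-L2t12g9-1 and abc-iut-L2-t7's «BOTH-MODEL SIZING»).  PROOF-ONLY: no definition, no instance, no
`Prop` fact; everything consumed BY NAME — abc-iut-w5-d095's `conj_inl_bPowGfp_etaDdχq` / `inflTheta_kumYdd_negOne_ne_one`
(`SettingModelTateDeckSignNoGo`, p491944), abc-iut-L2-t6's `conj_beta_logUdd` (`SettingModelTateDeckDisplayNegOne`),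
`GtpY_le_closure_beta_GtpYdd`, `mem_GtpYdd_modelχq_iff_left`, `bPowGfp_mem_dY_iff`, `ThetaSetting.inflTheta_conj_toTheta`,
the `ContH1.conj` calculus, abc-iut-L2-t8's `KummerData.etaleThetaDataOfClass`.

THE RECORD (p491944): for EVERY étale-theta datum `E` over `modelχq p i j` with `E.etaDd = η̈♯ := etaDdχq` the class-level
deck-sign clause «∀ ε ∈ Π^tp_Y ∖ Π^tp_Ÿ, conj_ε η̈ = κ(−1)·η̈» (binder `hdeck` of the IUTchII h14orbit route) is FALSE —
every element of `Π^tp_Y` fixes `η̈♯`; diagnosis of record «the stage-2 z-class ignores the y-coordinate».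
THIS FILE (numbers, not a side): at the SAME group `Π^tp_X = Γ ⋊ G_ℚp` of `modelχq p i j` (every `p`, `i`, even `j`),
the TWISTED class

  `η̈♯′ := η̈♯ · infl(log(Ü))`  (`etaDdχq * inflTheta (kummerCoreχq).logUdd`, `log(Ü) = c^{ŷ/2}` abc-iut-L6-d5's kit class)

DOES satisfy the clause:
* `conj_beta_inflTheta_logUdd` — `conj_β infl(log Ü) = infl(log Ü) · infl κ(−1)` for the basic deck element
  `β = (b, 1)` (inflation of `conj_beta_logUdd`);
* `conj_beta_etaDdTwistχq` — hence `conj_β η̈♯′ = infl κ(−1) · η̈♯′` (`β` fixes `η̈♯`);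
* `mem_GtpYdd_or_mem_GtpYdd_beta_inv_mul` — `Π^tp_Y = Π^tp_Ÿ ⊔ β·Π^tp_Ÿ` (from `Π^tp_Y ≤ ⟨β, Π^tp_Ÿ⟩`, `β² ∈ Π^tp_Ÿ`,
  normality): every `ε ∈ Π^tp_Y ∖ Π^tp_Ÿ` is `β·y` with `y ∈ Π^tp_Ÿ`;
* **`conj_etaDdTwistχq_of_not_mem_GtpYdd`** — for EVERY `ε ∈ Π^tp_Y ∖ Π^tp_Ÿ`: `conj_ε η̈♯′ = infl κ(−1) · η̈♯′`
  (and `conj_y η̈♯′ = η̈♯′` for `y ∈ Π^tp_Ÿ`);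
* **`hdeck_etaleThetaDataOfClass_etaDdTwistχq`** / **`exists_etaleThetaData_hdeck_modelχq`** — the étale-theta datum
  `(kummerCoreχq).toKummerData.etaleThetaDataOfClass η̈♯′` satisfies `hdeck` VERBATIM in the shape refuted for `η̈♯`
  (p491944 `not_hdeck_modelχq`): the (P14ii-cl) clause is INHABITED at `modelχq` — by a class, not by a new group;
* `hdeck_Huu_etaDdTwistχq` — the same in the `X̲̲`-restricted currency of the L6 consumers (every `X̲̲`-choice `C`);
* `etaDdTwistχq_ne_etaDdχq` — the twist is non-trivial (`infl log(Ü) ≠ 1`, since `β` moves it).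
WHAT IS NOT CLAIMED: the twisted class is NOT shown to satisfy the typed Prop. 1.5 (iii) `Z`-action law at `(i, j)`
(conjugation by the translation `(a, 1)` moves `log(Ü)` by a constant Kummer class, so the law of `η̈♯′` is that of a
neighbouring shear exponent — cf. the F4q header, «designated `(i, j) = (−1, 2)` vs record `(1, 2)`»), nor the inversion
clause for `inversionχq` (which would need re-centring by `Inn((a,1)^{±1})`); the joint package {Prop 1.5 (iii), inversion,
deck sign, Prop 1.5 (ii)} for a single class at a single `(i, j)` stays OPEN (census input for VNEXT add.13).  The
commutator-axis cusp datum (hIx, G-L2t12g9-1 proper) is a group-level question untouched here.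
HONEST FRAMING: SEMI-SYNTHETIC model — consistency / non-vacuity evidence for the typed interface ONLY; [EtTh] is refereed
and nothing of it is disputed or asserted here; inhabited-at-a-model ≠ proved; no side taken on [IUTchIII] Cor. 3.12.
-/

noncomputable section

namespace Literature.AnabelianGeometry.EtaleTheta.SettingModel

open Literature.AnabelianGeometry.SemiGraphs

variable (p : ℕ) [Fact p.Prime] (i j : ℤ)

/-! ### The basic deck element `β = (b, 1)` and the coset decomposition `Π^tp_Y = Π^tp_Ÿ ⊔ β·Π^tp_Ÿ` -/

/-- `β = (b, 1)` lies in `Π^tp_Y` and not in `Π^tp_Ÿ` (level-`2` `y`-coordinate `1`). [cite: MochizukiEtTh2009, §1 p.17] -/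
theorem inl_b_mem_GtpY_not_mem_GtpYdd_modelχq (hj : Even j) :
    (SemidirectProduct.inl (bPowGfp (iotaZ (Multiplicative.ofAdd 1))) : PiTpχq p i j) ∈
        (ThetaSetting.modelχq p i j hj).GtpY ∧
      (SemidirectProduct.inl (bPowGfp (iotaZ (Multiplicative.ofAdd 1))) : PiTpχq p i j) ∉
        (ThetaSetting.modelχq p i j hj).GtpYdd :=
  inl_bPowGfp_eta_one_mem_GtpY_not_mem_GtpYdd_modelχq p i j hj

/-- `β² = (b², 1)` lies in `Π^tp_Ÿ` (level-`2` `y`-coordinate `0`). [cite: MochizukiEtTh2009, §1 p.17] -/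
theorem inl_b_sq_mem_GtpYdd_modelχq (hj : Even j) :
    (SemidirectProduct.inl (bPowGfp (iotaZ (Multiplicative.ofAdd 1))) : PiTpχq p i j) *
        SemidirectProduct.inl (bPowGfp (iotaZ (Multiplicative.ofAdd 1))) ∈ (ThetaSetting.modelχq p i j hj).GtpYdd := by
  rw [← map_mul, ← map_mul, ← map_mul, mem_GtpYdd_modelχq_iff_left, SemidirectProduct.left_inl, bPowGfp_mem_dY_iff,
    map_mul]
  change ZHatLevel.level 2 (ZHatLevel.eta 1) * ZHatLevel.level 2 (ZHatLevel.eta 1) = 1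
  rw [ZHatLevel.level_eta]
  decide

/-- **`Π^tp_Y = Π^tp_Ÿ ⊔ β·Π^tp_Ÿ`**: every `ε ∈ Π^tp_Y` lies in `Π^tp_Ÿ` or in the coset `β·Π^tp_Ÿ`
(`Π^tp_Y ≤ ⟨β, Π^tp_Ÿ⟩`, `β² ∈ Π^tp_Ÿ`, `Π^tp_Ÿ ⊴ Π^tp_X`). [cite: MochizukiEtTh2009, §1 p.17] -/
theorem mem_GtpYdd_or_mem_GtpYdd_beta_inv_mul (hj : Even j) (hC : (ThetaSetting.modelχq p i j hj).Compat)
    {ε : PiTpχq p i j} (hε : ε ∈ (ThetaSetting.modelχq p i j hj).GtpY) :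
    ε ∈ (ThetaSetting.modelχq p i j hj).GtpYdd ∨
      (SemidirectProduct.inl (bPowGfp (iotaZ (Multiplicative.ofAdd 1))) : PiTpχq p i j)⁻¹ * ε ∈
        (ThetaSetting.modelχq p i j hj).GtpYdd := by
  haveI := hC.GtpYdd_normal
  set β : PiTpχq p i j := SemidirectProduct.inl (bPowGfp (iotaZ (Multiplicative.ofAdd 1))) with hβ
  set N := (ThetaSetting.modelχq p i j hj).GtpYdd with hN
  have hβ2 : β * β ∈ N := inl_b_sq_mem_GtpYdd_modelχq p i j hj
  -- conjugation by `β` and by `β⁻¹` preserves `N`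
  have hconj : ∀ {x}, x ∈ N → β⁻¹ * x * β ∈ N := fun {x} hx => by
    simpa using (inferInstance : N.Normal).conj_mem x hx β⁻¹
  have key : ∀ x ∈ Subgroup.closure ({β} ∪ (N : Set (PiTpχq p i j))), x ∈ N ∨ β⁻¹ * x ∈ N := by
    intro x hx
    induction hx using Subgroup.closure_induction with
    | mem x hx =>
      rcases hx with hx | hx
      · rw [Set.mem_singleton_iff] at hx
        subst hx
        exact Or.inr (by rw [inv_mul_cancel]; exact N.one_mem)
      · exact Or.inl hx
    | one => exact Or.inl N.one_mem
    | mul x y _ _ hx hy =>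
      rcases hx with hx | hx <;> rcases hy with hy | hy
      · exact Or.inl (N.mul_mem hx hy)
      · refine Or.inr ?_
        have : β⁻¹ * (x * y) = (β⁻¹ * x * β) * (β⁻¹ * y) := by group
        rw [this]
        exact N.mul_mem (hconj hx) hy
      · refine Or.inr ?_
        have : β⁻¹ * (x * y) = (β⁻¹ * x) * y := by group
        rw [this]
        exact N.mul_mem hx hy
      · refine Or.inl ?_
        have : x * y = (β * β) * ((β⁻¹ * (β⁻¹ * x) * β) * (β⁻¹ * y)) := by group
        rw [this]
        exact N.mul_mem hβ2 (N.mul_mem (hconj hx) hy)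
    | inv x _ hx =>
      rcases hx with hx | hx
      · exact Or.inl (N.inv_mem hx)
      · refine Or.inr ?_
        have : β⁻¹ * x⁻¹ = (β⁻¹ * (β⁻¹ * x)⁻¹ * β) * (β * β)⁻¹ := by group
        rw [this]
        exact N.mul_mem (hconj (N.inv_mem hx)) (N.inv_mem hβ2)
  exact key ε (GtpY_le_closure_beta_GtpYdd p i j hj hε)

/-! ### The twisted class `η̈♯′ = η̈♯ · infl(log Ü)` and the deck element -/

/-- **`conj_β infl(log Ü) = infl(log Ü) · infl κ(−1)`** at `modelχq p i j` — abc-iut-L2-t6's `conj_beta_logUdd` inflated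
from `(Π^tp_Ÿ)^Θ` to `Π^tp_Ÿ`. [cite: MochizukiEtTh2009, Prop 1.5 (iii) p.23] -/
theorem conj_beta_inflTheta_logUdd (hj : Even j) (hC : (ThetaSetting.modelχq p i j hj).Compat) :
    haveI := hC.GtpYdd_normal
    ContH1.conj (ThetaSetting.modelχq p i j hj).toTheta (ThetaSetting.modelχq p i j hj).DeltaTheta
        (SemidirectProduct.inl (bPowGfp (iotaZ (Multiplicative.ofAdd 1))) : PiTpχq p i j)
        ((ThetaSetting.modelχq p i j hj).inflTheta (ThetaSetting.modelχq p i j hj).GtpYdd (kummerCoreχq p i j hj).logUdd) =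
      (ThetaSetting.modelχq p i j hj).inflTheta (ThetaSetting.modelχq p i j hj).GtpYdd (kummerCoreχq p i j hj).logUdd *
        (ThetaSetting.modelχq p i j hj).inflTheta (ThetaSetting.modelχq p i j hj).GtpYdd
          ((kummerCoreχq p i j hj).toKummerData.kumYdd ((kummerCoreχq p i j hj).toKummerData.toKddHat (-1))) := by
  haveI := hC.GtpYdd_normal
  haveI := hC.GtpYddTheta_normal
  rw [← ThetaSetting.inflTheta_conj_toTheta hC, ← map_mul]
  exact congrArg _ (conj_beta_logUdd p i j hj hC)

/-- **`conj_β η̈♯′ = infl κ(−1) · η̈♯′`** for the twisted class `η̈♯′ = η̈♯ · infl(log Ü)`: `β` fixes `η̈♯`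
(`conj_inl_bPowGfp_etaDdχq`) and multiplies `infl(log Ü)` by `infl κ(−1)`. [cite: MochizukiEtTh2009, Prop 1.4 (ii) p.22] -/
theorem conj_beta_etaDdTwistχq (hj : Even j) (hC : (ThetaSetting.modelχq p i j hj).Compat) :
    haveI := hC.GtpYdd_normal
    ContH1.conj (ThetaSetting.modelχq p i j hj).toTheta (ThetaSetting.modelχq p i j hj).DeltaTheta
        (SemidirectProduct.inl (bPowGfp (iotaZ (Multiplicative.ofAdd 1))) : PiTpχq p i j)
        (etaDdχq p i j hj *
          (ThetaSetting.modelχq p i j hj).inflTheta (ThetaSetting.modelχq p i j hj).GtpYdd (kummerCoreχq p i j hj).logUdd) =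
      (ThetaSetting.modelχq p i j hj).inflTheta (ThetaSetting.modelχq p i j hj).GtpYdd
          ((kummerCoreχq p i j hj).toKummerData.kumYdd ((kummerCoreχq p i j hj).toKummerData.toKddHat (-1))) *
        (etaDdχq p i j hj *
          (ThetaSetting.modelχq p i j hj).inflTheta (ThetaSetting.modelχq p i j hj).GtpYdd (kummerCoreχq p i j hj).logUdd) := by
  haveI := hC.GtpYdd_normal
  rw [map_mul, conj_inl_bPowGfp_etaDdχq p i j hj hC, conj_beta_inflTheta_logUdd p i j hj hC, ← mul_assoc]
  exact mul_comm _ _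

/-- Elements of `Π^tp_Ÿ` fix the twisted class (inner action on `H¹(Π^tp_Ÿ, Δ_Θ)`). [cite: MochizukiEtTh2009, Prop 1.5 (iii) p.23] -/
theorem conj_etaDdTwistχq_eq_self_of_mem_GtpYdd (hj : Even j) (hC : (ThetaSetting.modelχq p i j hj).Compat)
    {y : PiTpχq p i j} (hy : y ∈ (ThetaSetting.modelχq p i j hj).GtpYdd) :
    haveI := hC.GtpYdd_normal
    ContH1.conj (ThetaSetting.modelχq p i j hj).toTheta (ThetaSetting.modelχq p i j hj).DeltaTheta y
        (etaDdχq p i j hj *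
          (ThetaSetting.modelχq p i j hj).inflTheta (ThetaSetting.modelχq p i j hj).GtpYdd (kummerCoreχq p i j hj).logUdd) =
      etaDdχq p i j hj *
        (ThetaSetting.modelχq p i j hj).inflTheta (ThetaSetting.modelχq p i j hj).GtpYdd (kummerCoreχq p i j hj).logUdd := by
  haveI := hC.GtpYdd_normal
  exact ContH1.conj_eq_self_of_mem _ hy _

/-- **(P14ii-cl) for the twisted class**: for EVERY `ε ∈ Π^tp_Y ∖ Π^tp_Ÿ` of `modelχq p i j` (any `p`, `i`, even `j`),
`conj_ε η̈♯′ = infl κ(−1) · η̈♯′` — `ε = β·y` with `y ∈ Π^tp_Ÿ` fixing the class and `β` multiplying it by `κ(−1)`.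
[cite: MochizukiEtTh2009, Prop 1.4 (ii) p.22] -/
theorem conj_etaDdTwistχq_of_not_mem_GtpYdd (hj : Even j) (hC : (ThetaSetting.modelχq p i j hj).Compat)
    {ε : PiTpχq p i j} (hε : ε ∈ (ThetaSetting.modelχq p i j hj).GtpY)
    (hε' : ε ∉ (ThetaSetting.modelχq p i j hj).GtpYdd) :
    haveI := hC.GtpYdd_normal
    ContH1.conj (ThetaSetting.modelχq p i j hj).toTheta (ThetaSetting.modelχq p i j hj).DeltaTheta ε
        (etaDdχq p i j hj *
          (ThetaSetting.modelχq p i j hj).inflTheta (ThetaSetting.modelχq p i j hj).GtpYdd (kummerCoreχq p i j hj).logUdd) =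
      (ThetaSetting.modelχq p i j hj).inflTheta (ThetaSetting.modelχq p i j hj).GtpYdd
          ((kummerCoreχq p i j hj).toKummerData.kumYdd ((kummerCoreχq p i j hj).toKummerData.toKddHat (-1))) *
        (etaDdχq p i j hj *
          (ThetaSetting.modelχq p i j hj).inflTheta (ThetaSetting.modelχq p i j hj).GtpYdd (kummerCoreχq p i j hj).logUdd) := by
  haveI := hC.GtpYdd_normal
  rcases mem_GtpYdd_or_mem_GtpYdd_beta_inv_mul p i j hj hC hε with h | h
  · exact absurd h hε'
  · -- `ε = β · (β⁻¹ ε)` with `β⁻¹ ε ∈ Π^tp_Ÿ`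
    have hεeq : ε = SemidirectProduct.inl (bPowGfp (iotaZ (Multiplicative.ofAdd 1))) *
        ((SemidirectProduct.inl (bPowGfp (iotaZ (Multiplicative.ofAdd 1))) : PiTpχq p i j)⁻¹ * ε) := by
      rw [mul_inv_cancel_left]
    conv_lhs => rw [hεeq]
    rw [ContH1.conj_mul_apply, conj_etaDdTwistχq_eq_self_of_mem_GtpYdd p i j hj hC h,
      conj_beta_etaDdTwistχq p i j hj hC]

/-! ### The `hdeck` binder is INHABITED at the model (positive twin of `not_hdeck_modelχq`) -/

/-- **`hdeck` HOLDS for the étale-theta datum `E′ := (kummerCoreχq).etaleThetaDataOfClass η̈♯′`** over `modelχq p i j`: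
«every `ε ∈ Π^tp_Y ∖ Π^tp_Ÿ` satisfies `conj_ε E′.etaDd = infl κ_{E′}(−1) · E′.etaDd`» — VERBATIM the clause refuted for
`η̈♯` itself (p491944 `not_hdeck_modelχq`). [cite: MochizukiEtTh2009, Prop 1.4 (ii) p.22] -/
theorem hdeck_etaleThetaDataOfClass_etaDdTwistχq (hj : Even j) (hC : (ThetaSetting.modelχq p i j hj).Compat) :
    haveI := hC.GtpYdd_normal
    let E' := (kummerCoreχq p i j hj).toKummerData.etaleThetaDataOfClass
      (etaDdχq p i j hj *
        (ThetaSetting.modelχq p i j hj).inflTheta (ThetaSetting.modelχq p i j hj).GtpYdd (kummerCoreχq p i j hj).logUdd)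
    ∀ ε : PiTpχq p i j, ε ∈ (ThetaSetting.modelχq p i j hj).GtpY → ε ∉ (ThetaSetting.modelχq p i j hj).GtpYdd →
      ContH1.conj (ThetaSetting.modelχq p i j hj).toTheta (ThetaSetting.modelχq p i j hj).DeltaTheta ε E'.etaDd =
        (ThetaSetting.modelχq p i j hj).inflTheta (ThetaSetting.modelχq p i j hj).GtpYdd
          (E'.kumYdd (E'.toKddHat (-1))) * E'.etaDd := by
  intro E' ε hε hε'
  exact conj_etaDdTwistχq_of_not_mem_GtpYdd p i j hj hC hε hε'

/-- **Census form (positive twin of p491944)**: at `modelχq p i j` (every `p`, `i`, even `j`, `Compat`) there IS an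
étale-theta datum `E` over the Kummer core of record whose class is the `log(Ü)`-twist `η̈♯ · infl(log Ü)` and which
satisfies the class-level deck-sign clause (P14ii-cl). [cite: MochizukiEtTh2009, Prop 1.4 (ii) p.22] -/
theorem exists_etaleThetaData_hdeck_modelχq (hj : Even j) (hC : (ThetaSetting.modelχq p i j hj).Compat) :
    haveI := hC.GtpYdd_normal
    ∃ E : (ThetaSetting.modelχq p i j hj).EtaleThetaData,
      E.toKummerData = (kummerCoreχq p i j hj).toKummerData ∧
      E.etaDd = etaDdχq p i j hj *
        (ThetaSetting.modelχq p i j hj).inflTheta (ThetaSetting.modelχq p i j hj).GtpYdd (kummerCoreχq p i j hj).logUdd ∧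
      ∀ ε : PiTpχq p i j, ε ∈ (ThetaSetting.modelχq p i j hj).GtpY → ε ∉ (ThetaSetting.modelχq p i j hj).GtpYdd →
        ContH1.conj (ThetaSetting.modelχq p i j hj).toTheta (ThetaSetting.modelχq p i j hj).DeltaTheta ε E.etaDd =
          (ThetaSetting.modelχq p i j hj).inflTheta (ThetaSetting.modelχq p i j hj).GtpYdd
            (E.kumYdd (E.toKddHat (-1))) * E.etaDd :=
  ⟨_, rfl, rfl, hdeck_etaleThetaDataOfClass_etaDdTwistχq p i j hj hC⟩

/-- **The same in the `X̲̲`-restricted currency of the L6 consumers** (positive twin of `not_hdeck_Huu_modelχq`): for every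
étale-theta datum `E` over the model and every `X̲̲`-choice `C : E.DoubleUnderline l`, every deck element INSIDE
`Π^tp_X̲̲ = C.Huu` multiplies `η̈♯′` by `infl κ(−1)`. [cite: MochizukiEtTh2009, Prop 1.4 (ii) p.22] -/
theorem hdeck_Huu_etaDdTwistχq (hj : Even j) (hC : (ThetaSetting.modelχq p i j hj).Compat)
    (E : (ThetaSetting.modelχq p i j hj).EtaleThetaData) {l : ℕ} (C : E.DoubleUnderline l) :
    haveI := hC.GtpYdd_normal
    ∀ ε ∈ C.Huu, ε ∈ (ThetaSetting.modelχq p i j hj).GtpY → ε ∉ (ThetaSetting.modelχq p i j hj).GtpYdd →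
      ContH1.conj (ThetaSetting.modelχq p i j hj).toTheta (ThetaSetting.modelχq p i j hj).DeltaTheta ε
          (etaDdχq p i j hj *
            (ThetaSetting.modelχq p i j hj).inflTheta (ThetaSetting.modelχq p i j hj).GtpYdd (kummerCoreχq p i j hj).logUdd) =
        (ThetaSetting.modelχq p i j hj).inflTheta (ThetaSetting.modelχq p i j hj).GtpYdd
            ((kummerCoreχq p i j hj).toKummerData.kumYdd ((kummerCoreχq p i j hj).toKummerData.toKddHat (-1))) *
          (etaDdχq p i j hj *
            (ThetaSetting.modelχq p i j hj).inflTheta (ThetaSetting.modelχq p i j hj).GtpYdd (kummerCoreχq p i j hj).logUdd) :=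
  fun _ _ hε hε' => conj_etaDdTwistχq_of_not_mem_GtpYdd p i j hj hC hε hε'

/-- **The twist is non-trivial**: `η̈♯′ ≠ η̈♯`, i.e. `infl(log Ü) ≠ 1` in `H¹(Π^tp_Ÿ, Δ_Θ)` — `β` fixes `1` but moves
`infl(log Ü)` by `infl κ(−1) ≠ 1`. [cite: MochizukiEtTh2009, Prop 1.5 (ii) p.23] -/
theorem etaDdTwistχq_ne_etaDdχq (hj : Even j) (hC : (ThetaSetting.modelχq p i j hj).Compat) :
    etaDdχq p i j hj *
        (ThetaSetting.modelχq p i j hj).inflTheta (ThetaSetting.modelχq p i j hj).GtpYdd (kummerCoreχq p i j hj).logUdd ≠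
      etaDdχq p i j hj := by
  haveI := hC.GtpYdd_normal
  intro h
  have h1 : (ThetaSetting.modelχq p i j hj).inflTheta (ThetaSetting.modelχq p i j hj).GtpYdd
      (kummerCoreχq p i j hj).logUdd = 1 := mul_left_cancel (a := etaDdχq p i j hj) (by rw [h, mul_one])
  have h2 := conj_beta_inflTheta_logUdd p i j hj hC
  rw [h1, map_one, one_mul] at h2
  exact inflTheta_kumYdd_negOne_ne_one p i j hj (kummerCoreχq p i j hj).toKummerData h2.symm

end Literature.AnabelianGeometry.EtaleTheta.SettingModel

end
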